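import Mathlib
import Summits.MatrixMultiplication.MatrixMultiplication.Theses.SnSubsetDichotomy

/-!
# `SnSubsetDichotomy.PolynomialSlack`, line `transport-split-hull` — stub `stub_transport`

The TRANSPORT INEQUALITY in count form (crux `stmt-MatrixMultiplication-8306`, registered stub
`stub_transport` of the lead's skeleton for line `transport-split-hull`).

The statement is free of the triple product property: for ANY finite subsets
`S, T, U, H₁, H₂, H₃` of a group with `(H₁, H₂, H₃)` exactly product-free
(`x ∈ H₁ → y ∈ H₂ → x * y ∉ H₃`), every triple `(s, t, u)` satisfies at most two of the three
conditions `s⁻¹ * t ∈ H₁`, `t⁻¹ * u ∈ H₂`, `s⁻¹ * u ∈ H₃`, because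
`(s⁻¹ * t) * (t⁻¹ * u) = s⁻¹ * u` (so the first two force `s⁻¹ * u ∈ H₁ · H₂`, hence `∉ H₃`).
Summing the three indicator functions over `S × T × U` and collecting fibres gives
`|U| · Σ_{t ∈ T} #{s ∈ S | s⁻¹t ∈ H₁} + |S| · Σ_{t ∈ T} #{u ∈ U | t⁻¹u ∈ H₂}
  + |T| · #{(s,u) ∈ S × U | s⁻¹u ∈ H₃} ≤ 2 |S| |T| |U|`.

Contents:
* `indicator_sum_le_two` — the pointwise bound (the only place `hH` is used);
* `transport_count_le` — the inequality for an arbitrary group with decidable equality, by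
  writing each of the three terms as a triple sum `∑ t ∈ T, ∑ s ∈ S, ∑ u ∈ U` of an indicator
  (`Finset.card_filter`, `Finset.mul_sum`, `Finset.sum_const`, `Finset.sum_product`) and summing
  the pointwise bound (`Finset.sum_le_sum`);
* `stub_transport` — the registered signature, in `S_n = Equiv.Perm (Fin n)`.

All arithmetic is in `ℕ`. Nothing here uses the triple product property and no Literature fact
is involved; the identification of the three counts with `|A ∩ H₁|·|U|`, `|B ∩ H₂|·|S|`,
`|C′ ∩ H₃|·|T|` under the TPP is the neighbouring stub `stub_split` and is NOT done here.
-/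

open scoped BigOperators
open Finset

-- `Summit.<Summit>.<Problem>` is the tree's mandated summit-side namespace (CONVENTIONS §2); for
-- this single-problem summit `<Summit> = <Problem>`, so the duplicate component is deliberate.
set_option linter.dupNamespace false

namespace Summit.MatrixMultiplication.MatrixMultiplication.Theorems.PolynomialSlack

/-- **Pointwise transport bound.** If `(H₁, H₂, H₃)` is exactly product-free
(`x ∈ H₁ → y ∈ H₂ → x * y ∉ H₃`) then for all `s t u` at most two of `s⁻¹ * t ∈ H₁`,
`t⁻¹ * u ∈ H₂`, `s⁻¹ * u ∈ H₃` hold, since `(s⁻¹ * t) * (t⁻¹ * u) = s⁻¹ * u`; in indicator form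
the three indicators sum to at most `2`. [folklore] -/
theorem indicator_sum_le_two {G : Type*} [Group G] [DecidableEq G] {H₁ H₂ H₃ : Finset G}
    (hH : ∀ x ∈ H₁, ∀ y ∈ H₂, x * y ∉ H₃) (s t u : G) :
    (if s⁻¹ * t ∈ H₁ then 1 else 0) + (if t⁻¹ * u ∈ H₂ then 1 else 0) +
        (if s⁻¹ * u ∈ H₃ then 1 else 0) ≤ (2 : ℕ) := by
  by_cases h₁ : s⁻¹ * t ∈ H₁
  · by_cases h₂ : t⁻¹ * u ∈ H₂
    · have h₃ : s⁻¹ * u ∉ H₃ := by simpa [mul_assoc] using hH _ h₁ _ h₂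
      simp [h₁, h₂, h₃]
    · by_cases h₃ : s⁻¹ * u ∈ H₃ <;> simp [h₁, h₂, h₃]
  · by_cases h₂ : t⁻¹ * u ∈ H₂ <;> by_cases h₃ : s⁻¹ * u ∈ H₃ <;> simp [h₁, h₂, h₃]

/-- **Transport inequality, count form, arbitrary group.** For finite subsets
`S, T, U, H₁, H₂, H₃` of a group with `(H₁, H₂, H₃)` exactly product-free,
`|U| · Σ_{t ∈ T} #{s ∈ S | s⁻¹t ∈ H₁} + |S| · Σ_{t ∈ T} #{u ∈ U | t⁻¹u ∈ H₂}
  + |T| · #{(s,u) ∈ S × U | s⁻¹u ∈ H₃} ≤ 2 |S| |T| |U|`: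
each of the three terms is the sum over `(t, s, u) ∈ T × S × U` of one indicator, and pointwise
the three indicators sum to at most `2` (`indicator_sum_le_two`). [folklore] -/
theorem transport_count_le {G : Type*} [Group G] [DecidableEq G] (S T U H₁ H₂ H₃ : Finset G)
    (hH : ∀ x ∈ H₁, ∀ y ∈ H₂, x * y ∉ H₃) :
    U.card * ∑ t ∈ T, (S.filter (fun s => s⁻¹ * t ∈ H₁)).card +
        S.card * ∑ t ∈ T, (U.filter (fun u => t⁻¹ * u ∈ H₂)).card +
        T.card * ((S ×ˢ U).filter (fun su => su.1⁻¹ * su.2 ∈ H₃)).card ≤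
      2 * (S.card * T.card * U.card) := by
  -- the three terms as triple sums of indicators over `(t, s, u) ∈ T × S × U`
  have h1 : U.card * ∑ t ∈ T, (S.filter (fun s => s⁻¹ * t ∈ H₁)).card =
      ∑ t ∈ T, ∑ s ∈ S, ∑ u ∈ U, (if s⁻¹ * t ∈ H₁ then 1 else 0 : ℕ) := by
    rw [Finset.mul_sum]
    refine Finset.sum_congr rfl fun t _ => ?_
    rw [Finset.card_filter, Finset.mul_sum]
    refine Finset.sum_congr rfl fun s _ => ?_
    rw [Finset.sum_const, smul_eq_mul]
  have h2 : S.card * ∑ t ∈ T, (U.filter (fun u => t⁻¹ * u ∈ H₂)).card =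
      ∑ t ∈ T, ∑ s ∈ S, ∑ u ∈ U, (if t⁻¹ * u ∈ H₂ then 1 else 0 : ℕ) := by
    rw [Finset.mul_sum]
    refine Finset.sum_congr rfl fun t _ => ?_
    rw [Finset.card_filter, Finset.sum_const, smul_eq_mul]
  have h3 : T.card * ((S ×ˢ U).filter (fun su => su.1⁻¹ * su.2 ∈ H₃)).card =
      ∑ t ∈ T, ∑ s ∈ S, ∑ u ∈ U, (if s⁻¹ * u ∈ H₃ then 1 else 0 : ℕ) := by
    rw [Finset.card_filter, Finset.sum_product, Finset.sum_const, smul_eq_mul]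
  -- the constant triple sum
  have h4 : ∑ t ∈ T, ∑ s ∈ S, ∑ u ∈ U, (2 : ℕ) = 2 * (S.card * T.card * U.card) := by
    simp only [Finset.sum_const, smul_eq_mul]
    ring
  calc U.card * ∑ t ∈ T, (S.filter (fun s => s⁻¹ * t ∈ H₁)).card +
        S.card * ∑ t ∈ T, (U.filter (fun u => t⁻¹ * u ∈ H₂)).card +
        T.card * ((S ×ˢ U).filter (fun su => su.1⁻¹ * su.2 ∈ H₃)).card
      = ∑ t ∈ T, ∑ s ∈ S, ∑ u ∈ U, ((if s⁻¹ * t ∈ H₁ then 1 else 0) +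
          (if t⁻¹ * u ∈ H₂ then 1 else 0) + (if s⁻¹ * u ∈ H₃ then 1 else 0) : ℕ) := by
        rw [h1, h2, h3]
        simp only [Finset.sum_add_distrib]
    _ ≤ ∑ t ∈ T, ∑ s ∈ S, ∑ u ∈ U, (2 : ℕ) :=
        Finset.sum_le_sum fun t _ => Finset.sum_le_sum fun s _ => Finset.sum_le_sum fun u _ =>
          indicator_sum_le_two hH s t u
    _ = 2 * (S.card * T.card * U.card) := h4

/-- **stub_transport** (THE TRANSPORT INEQUALITY, count form; TPP-free).
For ANY finite `S, T, U ⊆ S_n` and any exactly product-free `(H₁, H₂, H₃)`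
(`x ∈ H₁ → y ∈ H₂ → x * y ∉ H₃`), each triple `(s, t, u)` satisfies at most two of
`s⁻¹t ∈ H₁`, `t⁻¹u ∈ H₂`, `s⁻¹u ∈ H₃` (because `(s⁻¹t)(t⁻¹u) = s⁻¹u`); summing over
`S × T × U` and collecting fibres:
`|U|·Σ_t #{s ∈ S | s⁻¹t ∈ H₁} + |S|·Σ_t #{u ∈ U | t⁻¹u ∈ H₂} + |T|·#{(s,u) | s⁻¹u ∈ H₃} ≤ 2|S||T||U|`.
This is `transport_count_le` specialised to `S_n = Equiv.Perm (Fin n)`. [folklore] -/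
theorem stub_transport (n : ℕ) (S T U H₁ H₂ H₃ : Finset (Equiv.Perm (Fin n)))
    (hH : ∀ x ∈ H₁, ∀ y ∈ H₂, x * y ∉ H₃) :
    U.card * ∑ t ∈ T, (S.filter (fun s => s⁻¹ * t ∈ H₁)).card +
        S.card * ∑ t ∈ T, (U.filter (fun u => t⁻¹ * u ∈ H₂)).card +
        T.card * ((S ×ˢ U).filter (fun su => su.1⁻¹ * su.2 ∈ H₃)).card ≤
      2 * (S.card * T.card * U.card) := by
  exact transport_count_le S T U H₁ H₂ H₃ hH

end Summit.MatrixMultiplication.MatrixMultiplication.Theorems.PolynomialSlack
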